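import Summits.CriticalPhenomena.CardyFormulaZ2.Theorems.CardyMagicRigidityPinchResamplingDefsV4
import Summits.CriticalPhenomena.CardyFormulaZ2.Theorems.CardyMagicRigidityNestingRigidityZPinchRange
import Summits.CriticalPhenomena.CardyFormulaZ2.Theorems.CardyMagicRigidityNestingRigidityPhiGadget
import Literature.Probability.Percolation.RSW
import HarnessLib

/-!
# Crux `NestingRigidity`, line `pinch-resampling` (v4), stub S12: locality of the `ℤ²` neck objects (B1)

Crux `Summit.CriticalPhenomena.CardyFormulaZ2.Theses.CardyMagicRigidity.NestingRigidity`
(stmt-CriticalPhenomena-4835), line `pinch-resampling` v4, vocabulary `…PinchResamplingDefsV4` (p152476), stub S12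
`stub_neckHookupCoarseZ2 : NeckHookupCoarseZ2` (coarse measurability of the primal hook-up probability
`g = zHookProb x s` of the box `Λ_s(x)` given its exterior EDGES, critical bond percolation on `ℤ²`).
Brick B1 of the S12 brief = typing audit (A1), all VERIFIED: the three objects of the statement are EXTERIOR
objects of the box, as the consumer (identification step of S10') needs.

* §1 Geometry: a pair whose dual pair avoids the dual index box `zDualBall x n` (radius `n + ½`) avoids the
  primal box `Λ_n(x)` (`NeckCoarseZ2.not_mem_zBall_of_dualEdge`) — the design property of `zDualBall` claimed
  in the Defs docstring ("every dual edge between two dual vertices outside it crosses a primal edge with both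
  endpoints outside `Λ_n(x)`"), now proved; the lattice edges MEETING a box are finitely many
  (`NeckCoarseZ2.finite_compl_zExtEdges_inter_edgeSet`; the complement of `zExtEdges x s` itself is infinite —
  it contains the non-lattice pairs with a vertex in the box, `P_{1/2}`-a.s. closed).
* §2 The selection event `ZFourStrands x s` is determined by the exterior pairs `zExtEdges x s`
  (`zFourStrands_determinedBy`, registered anchor) and is measurable; the primal hook-up `ZHookR x s` is
  determined by the pairs inside `Λ_{2s}(x)` and is measurable; the coarse datum `zCoarse ℓ lam s x o` reads
  only the pairs inside the collar `Λ_{2s}(x) ∖ Λ_s(x)`, hence only exterior pairs (`zCoarse_congr`,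
  `zCoarse_congr_of_inter_zExtEdges`); `zHookProb x s` reads only exterior pairs (`zHookProb_congr`).
  (NB `openGraph ω = fromEdgeSet ω` also reads NON-lattice pairs; all statements here are sure-event
  statements valid for every configuration, junk pairs included.)

* §3 Brick B2, the STRUCTURE LEMMA (`zHookProb_eq_of_blobs_agree`): `g^{ℤ²}_{x,s}` is a function of the FINE blob
  datum of the collar — the traces on the inner layer of the blobs `blobOf (openGraph ω) (Λ_{2s}(x) ∖ Λ_s(x)) v` of the
  inner-layer vertices `v`, with their crossing flags: two exteriors with the same fine datum have the same `zHookProb`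
  (path surgery `NeckCoarseZ2.pathIn_of_blobTraces` on `P_{1/2}`-a.e. lattice samples of the hole).  This is WHY the coarse
  datum of S12 carries blob PARTITION information (typing note §2), and the exact list of what `g` can depend on.

Sequel: `…NestingRigidityNeckCoarseZ2Reduction` (the bond product formula and the reduction of S12 to a
surrogate-event estimate).
-/

noncomputable section

namespace Summit.CriticalPhenomena.CardyFormulaZ2.Cruxes.NestingRigidity.PinchResampling

open MeasureTheory Set Literature.Probability.Percolation Literature.Probability.LatticeModels
open ZPinchLocality

namespace NeckCoarseZ2

/-! ## §1 Geometry: dual pairs off the dual box cross primal pairs off the box -/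

/-- The primal box `Λ_n(x)` lies inside the dual index box of radius `n + ½`. -/
theorem zBall_subset_zDualBall (x : Site 2) (n : ℕ) : zBall x n ⊆ zDualBall x n := by
  intro v hv
  rw [mem_zBall_iff] at hv
  rw [mem_zDualBall_iff]
  simp only [abs_le] at hv ⊢
  omega

/-- **A pair whose dual pair avoids the dual box of radius `n + ½` avoids `Λ_n(x)`.**  For a lattice edge
`{u, u + eᵢ}` the dual pair is `{u - e_{1-i}, u}` (`dualEdge_horizontal`, `dualEdge_vertical`); if the common
index `u` is off the dual box then one coordinate of `u - x` is `≤ -n-2` or `≥ n+1`, so both `u` and `u + eᵢ` are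
off `Λ_n(x)`; off the edge set `dualEdge` is the identity and `Λ_n(x) ⊆ zDualBall x n`.  This is the design
property of the dual boxes: dual edges of the dual collar cross primal edges with no endpoint in the box. -/
theorem not_mem_zBall_of_dualEdge {x : Site 2} {n : ℕ} {e : Sym2 (Site 2)}
    (he : ∀ u ∈ dualEdge e, u ∉ zDualBall x n) : ∀ v ∈ e, v ∉ zBall x n := by
  by_cases hE : e ∈ (zdGraph 2).edgeSet
  · obtain ⟨u, i, rfl⟩ := mem_edgeSet_zdGraph_iff.1 hE
    have hu : u ∉ zDualBall x n := by
      fin_cases i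
      · simp only [Fin.zero_eta] at he
        rw [dualEdge_horizontal] at he
        exact he u (Sym2.mem_mk_right _ _)
      · simp only [Fin.mk_one] at he
        rw [dualEdge_vertical] at he
        exact he u (Sym2.mem_mk_right _ _)
    rw [mem_zDualBall_iff] at hu
    simp only [abs_le] at hu
    intro v hv
    rw [mem_zBall_iff]
    simp only [abs_le]
    rcases Sym2.mem_iff.1 hv with rfl | rfl
    · omega
    · fin_cases i
      · simp only [Fin.zero_eta, Fin.isValue, Pi.add_apply, Pi.single_eq_same, ne_eq, one_ne_zero,
          not_false_eq_true, Pi.single_eq_of_ne, add_zero]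
        omega
      · simp only [Fin.mk_one, Fin.isValue, Pi.add_apply, ne_eq, zero_ne_one, not_false_eq_true,
          Pi.single_eq_of_ne, add_zero, Pi.single_eq_same]
        omega
  · rw [dualEdge_of_not_mem hE] at he
    exact fun v hv hvB ↦ he v hv (zBall_subset_zDualBall x n hvB)

/-- Boxes grow with the radius. -/
theorem zBall_subset_zBall_succ (x : Site 2) (s : ℕ) : zBall x s ⊆ zBall x (s + 1) := by
  intro v hv
  rw [mem_zBall_iff] at hv ⊢
  simp only [abs_le, Nat.cast_add, Nat.cast_one] at hv ⊢
  omega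

/-- A lattice neighbour of a point of `Λ_s(x)` lies in `Λ_{s+1}(x)`. -/
theorem mem_zBall_succ_of_adj {x v w : Site 2} {s : ℕ} (hv : v ∈ zBall x s) (h : (zdGraph 2).Adj v w) :
    w ∈ zBall x (s + 1) := by
  rw [mem_zBall_iff] at hv ⊢
  rw [zdGraph_two_adj_iff] at h
  simp only [abs_le, Nat.cast_add, Nat.cast_one] at hv ⊢
  omega

/-- The lattice edges MEETING the box `Λ_s(x)` (the complement of the exterior pairs, cut down to the edge set)
are finitely many: they are pairs inside `Λ_{s+1}(x)`. -/
theorem finite_compl_zExtEdges_inter_edgeSet (x : Site 2) (s : ℕ) :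
    ((zExtEdges x s)ᶜ ∩ (zdGraph 2).edgeSet).Finite := by
  refine (finite_sym2 (zBall_finite x (s + 1))).subset ?_
  rintro e ⟨he, hE⟩
  induction e using Sym2.ind with
  | h a b =>
    rw [SimpleGraph.mem_edgeSet] at hE
    have he' : a ∈ zBall x s ∨ b ∈ zBall x s := by
      by_contra h
      rw [not_or] at h
      exact he fun v hv ↦ by
        rcases Sym2.mem_iff.1 hv with rfl | rfl
        · exact h.1
        · exact h.2
    rw [Set.mk_mem_sym2_iff]
    rcases he' with ha | hb
    · exact ⟨zBall_subset_zBall_succ x s ha, mem_zBall_succ_of_adj ha hE⟩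
    · exact ⟨mem_zBall_succ_of_adj hb hE.symm, zBall_subset_zBall_succ x s hb⟩

end NeckCoarseZ2

open NeckCoarseZ2

/-! ## §2 B1: exterior-determinedness and measurability of the S12 objects -/

/-- `ZFourStrands` is the intersection of its primal half and its dual half (definitional). -/
theorem zFourStrands_eq_inter (x : Site 2) (s : ℕ) :
    ZFourStrands x s =
      {ω | TwoCrossingClusters (zdGraph 2) (openGraph ω) (zBall x s) (zBall x (2 * s))} ∩
        {ω | TwoCrossingClusters (zdGraph 2) (openGraph (dualConfig ω)) (zDualBall x s) (zDualBall x (2 * s))} :=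
  rfl

/-- The determining pair set of the selection event: the pairs inside the primal collar together with the
`dualEdge`-preimages of the pairs inside the dual collar. -/
theorem zFourStrands_determinedBy_pairs (x : Site 2) (s : ℕ) :
    DeterminedBy (ZFourStrands x s)
      ((zBall x (2 * s) \ zBall x s).sym2 ∪ dualEdge ⁻¹' (zDualBall x (2 * s) \ zDualBall x s).sym2) := by
  rw [zFourStrands_eq_inter]
  exact (determinedBy_twoCrossingClusters (zdGraph 2) (zBall x s) (zBall x (2 * s)) subset_union_left).inter
    (determinedBy_twoCrossingClusters_dualConfig (zDualBall x s) (zDualBall x (2 * s)) subset_union_right)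

/-- That determining pair set is finite (`dualEdge` is injective). -/
theorem zFourStrandsPairs_finite (x : Site 2) (s : ℕ) :
    ((zBall x (2 * s) \ zBall x s).sym2 ∪ dualEdge ⁻¹' (zDualBall x (2 * s) \ zDualBall x s).sym2).Finite :=
  (finite_sym2 ((zBall_finite x _).subset fun _ h ↦ h.1)).union
    (Set.Finite.preimage dualEdge_bijective.injective.injOn
      (finite_sym2 ((zDualBall_finite x _).subset fun _ h ↦ h.1)))

/-- **The selection event `ZFourStrands x s` is measurable.** -/
theorem measurableSet_zFourStrands (x : Site 2) (s : ℕ) : MeasurableSet (ZFourStrands x s) := by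
  have h := zFourStrands_determinedBy_pairs x s
  rw [← (zFourStrandsPairs_finite x s).coe_toFinset] at h
  exact h.measurableSet_of_finset

/-- **Typing audit (A1): the selection event is an EXTERIOR event of the box** — `ZFourStrands x s` is
determined by the pairs with no endpoint in `Λ_s(x)` (primal collar pairs avoid the box by definition; dual
collar pairs by `not_mem_zBall_of_dualEdge`). -/
theorem zFourStrands_determinedBy : ∀ (x : Site 2) (s : ℕ), DeterminedBy (ZFourStrands x s) (zExtEdges x s) := by
  intro x s
  refine (zFourStrands_determinedBy_pairs x s).mono ?_
  rintro e (he | he)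
  · exact fun v hv ↦ ((Set.mem_sym2_iff_subset.1 he) hv).2
  · exact not_mem_zBall_of_dualEdge fun u hu ↦ ((Set.mem_sym2_iff_subset.1 he) hu).2

/-- The primal hook-up `ZHookR x s` is determined by the pairs inside `Λ_{2s}(x)`. -/
theorem zHookR_determinedBy (x : Site 2) (s : ℕ) : DeterminedBy (ZHookR x s) (zBall x (2 * s)).sym2 :=
  determinedBy_hookedUp (zdGraph 2) (zBall x s) (zBall x (2 * s)) Subset.rfl

/-- The primal hook-up `ZHookR x s` is measurable. -/
theorem measurableSet_zHookR (x : Site 2) (s : ℕ) : MeasurableSet (ZHookR x s) := by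
  have h := zHookR_determinedBy x s
  rw [← (finite_sym2 (zBall_finite x (2 * s))).coe_toFinset] at h
  exact h.measurableSet_of_finset

/-- `blobOf H A v` only reads the adjacency of `H` inside `A`. -/
theorem NeckCoarseZ2.blobOf_congr {V : Type*} {H H' : SimpleGraph V} {A : Set V}
    (hadj : ∀ a b, a ∈ A → b ∈ A → (H.Adj a b ↔ H'.Adj a b)) (v : V) : blobOf H A v = blobOf H' A v := by
  ext w
  exact pathIn_congr hadj v w

/-- `coarseBlobs G H I O N ℓ lam o` only reads the adjacency of the colour graph `H` inside the annulus `O ∖ I`. -/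
theorem NeckCoarseZ2.coarseBlobs_congr {G H H' : SimpleGraph (Site 2)} {I O : Set (Site 2)}
    (hadj : ∀ a b, a ∈ O \ I → b ∈ O \ I → (H.Adj a b ↔ H'.Adj a b)) (N : Site 2 → ℤ) (ℓ lam : ℕ)
    (o : Site 2) : coarseBlobs G H I O N ℓ lam o = coarseBlobs G H' I O N ℓ lam o := by
  simp only [coarseBlobs, NeckCoarseZ2.blobOf_congr hadj]

/-- **The coarse datum reads only the pairs inside the collar `Λ_{2s}(x) ∖ Λ_s(x)`.** -/
theorem zCoarse_congr {ℓ lam s : ℕ} {x o : Site 2} {ω ω' : BondConfig (Site 2)}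
    (h : ω ∩ (zBall x (2 * s) \ zBall x s).sym2 = ω' ∩ (zBall x (2 * s) \ zBall x s).sym2) :
    zCoarse ℓ lam s x o ω = zCoarse ℓ lam s x o ω' :=
  NeckCoarseZ2.coarseBlobs_congr (openGraph_adj_congr_of_inter_eq Subset.rfl h) zNorm ℓ lam o

/-- The collar pairs are exterior pairs of the box. -/
theorem NeckCoarseZ2.collar_sym2_subset_zExtEdges (x : Site 2) (s : ℕ) :
    (zBall x (2 * s) \ zBall x s).sym2 ⊆ zExtEdges x s :=
  fun _ he _ hv ↦ ((Set.mem_sym2_iff_subset.1 he) hv).2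

/-- **Typing audit (A1): the coarse datum is exterior-determined** — configurations agreeing on the exterior
pairs of the box have the same `zCoarse`. -/
theorem zCoarse_congr_of_inter_zExtEdges {ℓ lam s : ℕ} {x o : Site 2} {ω ω' : BondConfig (Site 2)}
    (h : ω ∩ zExtEdges x s = ω' ∩ zExtEdges x s) : zCoarse ℓ lam s x o ω = zCoarse ℓ lam s x o ω' := by
  have hsub := NeckCoarseZ2.collar_sym2_subset_zExtEdges x s
  refine zCoarse_congr (Set.ext fun e ↦ ⟨?_, ?_⟩)
  · rintro ⟨he, hC⟩
    exact ⟨((Set.ext_iff.1 h e).1 ⟨he, hsub hC⟩).1, hC⟩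
  · rintro ⟨he, hC⟩
    exact ⟨((Set.ext_iff.1 h e).2 ⟨he, hsub hC⟩).1, hC⟩

/-- **Typing audit (A1): `g^{ℤ²}` is exterior-determined** — `zHookProb x s` reads only the exterior pairs
(`condProbOff_congr`). -/
theorem zHookProb_congr {x : Site 2} {s : ℕ} {ω ω' : BondConfig (Site 2)}
    (h : ω ∩ zExtEdges x s = ω' ∩ zExtEdges x s) : zHookProb x s ω = zHookProb x s ω' :=
  condProbOff_congr _ _ _ (by rw [Set.sdiff_eq, Set.sdiff_eq, compl_compl, h])

namespace NeckCoarseZ2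

/-! ## §3 B2: the hook-up through a resampled hole only reads the blob traces on the inner layer -/

section Structure

variable {V : Type*}

/-- **Path surgery (the combinatorial core of B2).**  Two "spliced" colour graphs `H₁`, `H₂` on the big region `O`
that (i) agree with exterior graphs `E₁`, `E₂` on pairs inside the annulus `O ∖ I`, (ii) agree with each other on
pairs with an endpoint in the hole `I`, (iii) whose pairs out of the hole are lattice (`G`-)pairs, and (iv) whose
exterior graphs have the same blob traces on the inner layer (`w ∈ blobOf E₁ (O ∖ I) v ↔ w ∈ blobOf E₂ (O ∖ I) v` for
inner-layer `v, w`), join the same pairs of inner-layer vertices inside `O`.  (Induction along the path: maximal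
exterior segments run inside ONE blob between inner-layer vertices — a lattice pair leaving the hole lands on the
inner layer — and are replaced by `E₂`-paths; interior steps are kept.) -/
theorem pathIn_of_blobTraces {G H₁ H₂ E₁ E₂ : SimpleGraph V} {I O : Set V}
    (hext₁ : ∀ a b, a ∈ O \ I → b ∈ O \ I → (H₁.Adj a b ↔ E₁.Adj a b))
    (hext₂ : ∀ a b, a ∈ O \ I → b ∈ O \ I → (H₂.Adj a b ↔ E₂.Adj a b))
    (hint : ∀ a b, a ∈ I → (H₁.Adj a b ↔ H₂.Adj a b))
    (hlat : ∀ a b, a ∈ I → H₁.Adj a b → G.Adj a b)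
    (hblob : ∀ v ∈ innerLayer G I O, ∀ w ∈ innerLayer G I O, w ∈ blobOf E₁ (O \ I) v → w ∈ blobOf E₂ (O \ I) v)
    {v w : V} (hv : v ∈ innerLayer G I O) (hw : w ∈ innerLayer G I O) (h : PathIn H₁ O v w) :
    PathIn H₂ O v w := by
  -- blob paths of `E₂` are `H₂`-paths of `O`
  have hlift : ∀ z u, PathIn E₂ (O \ I) z u → PathIn H₂ O z u := fun z u hp ↦
    (DCT16.pathIn_congrGraph (fun a b ha hb hab ↦ (hext₂ a b ha hb).2 hab) hp).mono Set.sdiff_subset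
  -- the invariant along the `H₁`-path
  have key : (w ∈ I ∧ PathIn H₂ O v w) ∨
      (∃ z ∈ innerLayer G I O, PathIn H₂ O v z ∧ w ∈ blobOf E₁ (O \ I) z) := by
    refine DCT16.pathIn_induction
      (fun u ↦ (u ∈ I ∧ PathIn H₂ O v u) ∨ ∃ z ∈ innerLayer G I O, PathIn H₂ O v z ∧ u ∈ blobOf E₁ (O \ I) z)
      h (Or.inr ⟨v, hv, PathIn.refl hv.1.1, PathIn.refl hv.1⟩) ?_
    rintro a b haO hbO (⟨haI, hva⟩ | ⟨z, hz, hvz, haz⟩) hab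
    · -- `a` in the hole: the step is an interior step, shared by `H₂`
      have hab₂ : H₂.Adj a b := (hint a b haI).1 hab
      by_cases hbI : b ∈ I
      · exact Or.inl ⟨hbI, hva.tail hab₂ hbO⟩
      · exact Or.inr ⟨b, ⟨⟨hbO, hbI⟩, a, haI, (hlat a b haI hab).symm⟩, hva.tail hab₂ hbO, PathIn.refl ⟨hbO, hbI⟩⟩
    · -- `a` in the blob of the inner-layer vertex `z`
      have haOI : a ∈ O \ I := haz.right_mem
      by_cases hbI : b ∈ I
      · -- the step enters the hole: `a` is on the inner layer, so `a ∈ blobOf E₂ _ z`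
        have hba₁ : H₁.Adj b a := hab.symm
        have haInner : a ∈ innerLayer G I O := ⟨haOI, b, hbI, (hlat b a hbI hba₁).symm⟩
        have hza : PathIn H₂ O z a := hlift z a (hblob z hz a haInner haz)
        have hab₂ : H₂.Adj a b := ((hint b a hbI).1 hba₁).symm
        exact Or.inl ⟨hbI, (hvz.trans hza).tail hab₂ hbO⟩
      · -- the step stays in the annulus: same blob
        exact Or.inr ⟨z, hz, hvz, haz.tail ((hext₁ a b haOI ⟨hbO, hbI⟩).1 hab) ⟨hbO, hbI⟩⟩
  rcases key with ⟨hwI, -⟩ | ⟨z, hz, hvz, hwz⟩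
  · exact absurd hwI hw.1.2
  · exact hvz.trans (hlift z w (hblob z hz w hw hwz))

/-- Crossings only read the blob of the start vertex and whether it meets the outer layer. -/
theorem isCrossing_iff_blobOf {G H E : SimpleGraph V} {I O : Set V}
    (hext : ∀ a b, a ∈ O \ I → b ∈ O \ I → (H.Adj a b ↔ E.Adj a b)) (v : V) :
    IsCrossing G H I O v ↔ v ∈ innerLayer G I O ∧ ∃ u ∈ blobOf E (O \ I) v, u ∈ outerLayer G I O := by
  simp only [IsCrossing, blobOf, mem_setOf_eq, pathIn_congr hext]
  exact and_congr_right fun _ ↦ ⟨fun ⟨w, hw, hp⟩ ↦ ⟨w, hp, hw⟩, fun ⟨u, hp, hu⟩ ↦ ⟨u, hu, hp⟩⟩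

/-- **Hook-up transfer.**  Under the hypotheses of `pathIn_of_blobTraces` in both directions and equality of the
crossing flags of the blobs of inner-layer vertices, `H₁` is hooked up iff `H₂` is. -/
theorem hookedUp_iff_of_blobTraces {G H₁ H₂ E₁ E₂ : SimpleGraph V} {I O : Set V}
    (hext₁ : ∀ a b, a ∈ O \ I → b ∈ O \ I → (H₁.Adj a b ↔ E₁.Adj a b))
    (hext₂ : ∀ a b, a ∈ O \ I → b ∈ O \ I → (H₂.Adj a b ↔ E₂.Adj a b))
    (hint : ∀ a b, a ∈ I → (H₁.Adj a b ↔ H₂.Adj a b))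
    (hlat₁ : ∀ a b, a ∈ I → H₁.Adj a b → G.Adj a b)
    (hblob : ∀ v ∈ innerLayer G I O, ∀ w ∈ innerLayer G I O,
      (w ∈ blobOf E₁ (O \ I) v ↔ w ∈ blobOf E₂ (O \ I) v))
    (hflag : ∀ v ∈ innerLayer G I O,
      ((∃ u ∈ blobOf E₁ (O \ I) v, u ∈ outerLayer G I O) ↔ ∃ u ∈ blobOf E₂ (O \ I) v, u ∈ outerLayer G I O)) :
    HookedUp G H₁ I O ↔ HookedUp G H₂ I O := by
  have hlat₂ : ∀ a b, a ∈ I → H₂.Adj a b → G.Adj a b := fun a b ha hab ↦ hlat₁ a b ha ((hint a b ha).2 hab)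
  have hint' : ∀ a b, a ∈ I → (H₂.Adj a b ↔ H₁.Adj a b) := fun a b ha ↦ (hint a b ha).symm
  have hcross : ∀ u, IsCrossing G H₁ I O u ↔ IsCrossing G H₂ I O u := fun u ↦ by
    rw [isCrossing_iff_blobOf hext₁, isCrossing_iff_blobOf hext₂]
    exact and_congr_right fun hu ↦ hflag u hu
  constructor
  · intro hH v w hv hw
    rw [← hcross] at hv hw
    exact pathIn_of_blobTraces hext₁ hext₂ hint hlat₁ (fun a ha b hb ↦ (hblob a ha b hb).1) hv.1 hw.1
      (hH v w hv hw)
  · intro hH v w hv hw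
    rw [hcross] at hv hw
    exact pathIn_of_blobTraces hext₂ hext₁ hint' hlat₂ (fun a ha b hb ↦ (hblob a ha b hb).2) hv.1 hw.1
      (hH v w hv hw)

end Structure

/-! ### The `ℤ²` instance: splices through the box -/

/-- Adjacency of the open graph of a splice `(ξ ∩ K) ∪ (ω ∖ K)` on a pair off `K`. -/
theorem openGraph_splice_adj_of_not_mem {V : Type*} {K ξ ω : Set (Sym2 V)} {a b : V} (h : s(a, b) ∉ K) :
    (openGraph (ξ ∩ K ∪ ω \ K)).Adj a b ↔ (openGraph ω).Adj a b := by
  simp only [openGraph_adj, mem_union, mem_inter_iff, Set.mem_sdiff, h, and_false, not_false_eq_true, and_true,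
    false_or]

/-- Adjacency of the open graph of a splice `(ξ ∩ K) ∪ (ω ∖ K)` on a pair in `K`. -/
theorem openGraph_splice_adj_of_mem {V : Type*} {K ξ ω : Set (Sym2 V)} {a b : V} (h : s(a, b) ∈ K) :
    (openGraph (ξ ∩ K ∪ ω \ K)).Adj a b ↔ (openGraph ξ).Adj a b := by
  simp only [openGraph_adj, mem_union, mem_inter_iff, Set.mem_sdiff, h, and_true, not_true_eq_false, and_false,
    or_false]

/-- A pair inside the collar is an exterior pair (not in the resampled set). -/
theorem mk_not_mem_compl_zExtEdges {x : Site 2} {s : ℕ} {a b : Site 2}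
    (ha : a ∈ zBall x (2 * s) \ zBall x s) (hb : b ∈ zBall x (2 * s) \ zBall x s) :
    s(a, b) ∉ (zExtEdges x s)ᶜ := by
  rw [mem_compl_iff, not_not]
  intro v hv
  rcases Sym2.mem_iff.1 hv with rfl | rfl
  · exact ha.2
  · exact hb.2

end NeckCoarseZ2

/-- **B2, the structure lemma for `g^{ℤ²}` (S12 brick): the hook-up probability of the box given its exterior is a
function of the FINE blob datum of the collar** — the traces `blobOf (openGraph ω) (Λ_{2s}(x) ∖ Λ_s(x)) v ∩ innerLayer`
of the blobs of the inner-layer vertices `v` together with their crossing flags (whether the blob meets the outer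
layer).  Two exterior configurations with the same fine datum have the same `zHookProb x s`: for a LATTICE sample `ξ` of
the pairs meeting the box (`P_{1/2}`-a.s.), an open path of `Λ_{2s}(x)` between crossings alternates between interior
excursions (shared) and exterior segments, each inside one blob between two inner-layer vertices
(`NeckCoarseZ2.pathIn_of_blobTraces`), so the hook-up events of the two splices agree `P_{1/2}`-a.e. in `ξ`.  Nothing else of
the exterior matters (closed pairs, blobs not touching the inner layer, the geometry of a blob away from the inner
layer); in particular `g` is NOT a function of coarser data in general — the typing note's reason for the blob
PARTITION datum. -/
theorem zHookProb_eq_of_blobs_agree (x : Site 2) (s : ℕ) {ω ω' : BondConfig (Site 2)}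
    (hblob : ∀ v ∈ innerLayer (zdGraph 2) (zBall x s) (zBall x (2 * s)),
      ∀ w ∈ innerLayer (zdGraph 2) (zBall x s) (zBall x (2 * s)),
        (w ∈ blobOf (openGraph ω) (zBall x (2 * s) \ zBall x s) v ↔
          w ∈ blobOf (openGraph ω') (zBall x (2 * s) \ zBall x s) v))
    (hflag : ∀ v ∈ innerLayer (zdGraph 2) (zBall x s) (zBall x (2 * s)),
      ((∃ u ∈ blobOf (openGraph ω) (zBall x (2 * s) \ zBall x s) v,
          u ∈ outerLayer (zdGraph 2) (zBall x s) (zBall x (2 * s))) ↔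
        ∃ u ∈ blobOf (openGraph ω') (zBall x (2 * s) \ zBall x s) v,
          u ∈ outerLayer (zdGraph 2) (zBall x s) (zBall x (2 * s)))) :
    zHookProb x s ω = zHookProb x s ω' := by
  simp only [zHookProb, condProbOff]
  refine measureReal_congr ?_
  -- the two `ξ`-events agree on lattice samples
  have hae := ae_subset_edgeSet (zdGraph 2) half
  refine Filter.eventuallyEq_set.2 (hae.mono fun ξ hξ ↦ ?_)
  simp only [mem_setOf_eq, ZHookR]
  set K : Set (Sym2 (Site 2)) := (zExtEdges x s)ᶜ with hK
  set I : Set (Site 2) := zBall x s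
  set O : Set (Site 2) := zBall x (2 * s)
  have hext : ∀ (ζ : BondConfig (Site 2)) (a b : Site 2), a ∈ O \ I → b ∈ O \ I →
      ((openGraph (ξ ∩ K ∪ ζ \ K)).Adj a b ↔ (openGraph ζ).Adj a b) := fun ζ a b ha hb ↦
    NeckCoarseZ2.openGraph_splice_adj_of_not_mem (NeckCoarseZ2.mk_not_mem_compl_zExtEdges ha hb)
  have hintK : ∀ (ζ : BondConfig (Site 2)) (a b : Site 2), a ∈ I →
      ((openGraph (ξ ∩ K ∪ ζ \ K)).Adj a b ↔ (openGraph ξ).Adj a b) := fun ζ a b ha ↦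
    NeckCoarseZ2.openGraph_splice_adj_of_mem
      (show s(a, b) ∈ (zExtEdges x s)ᶜ from fun h ↦ h a (Sym2.mem_mk_left _ _) ha)
  have hint : ∀ a b : Site 2, a ∈ I →
      ((openGraph (ξ ∩ K ∪ ω \ K)).Adj a b ↔ (openGraph (ξ ∩ K ∪ ω' \ K)).Adj a b) := fun a b ha ↦ by
    rw [hintK ω a b ha, hintK ω' a b ha]
  have hlat : ∀ a b : Site 2, a ∈ I → (openGraph (ξ ∩ K ∪ ω \ K)).Adj a b → (zdGraph 2).Adj a b := by
    intro a b ha hab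
    rw [hintK ω a b ha, openGraph_adj] at hab
    exact (SimpleGraph.mem_edgeSet _).1 (hξ hab.1)
  exact NeckCoarseZ2.hookedUp_iff_of_blobTraces (hext ω) (hext ω') hint hlat hblob hflag

end Summit.CriticalPhenomena.CardyFormulaZ2.Cruxes.NestingRigidity.PinchResampling

end
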